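import Summits.AtomisticToContinuum.FouriersLaw.Theses.BondHeatUncertainty
import Summits.AtomisticToContinuum.FouriersLaw.Theorems.ExtensiveSnapshotIrreversibility.Negative.DegenerateInstances

/-!
# Line `jensen-thouless-window` — skeleton for crux `ExtensiveSnapshotIrreversibility` (K)

Crux item `stmt-AtomisticToContinuum-9121`, route `BondHeatUncertainty` (rank 3):
`KL(μ_{N,T+δ/2,T-δ/2} ‖ Θ_* μ_{N,T+δ/2,T-δ/2}) ≤ C·N·δ²` eventually in `δ`, for every `N`
(`Θ(q,p) = (q,-p)`), under weak-NESS uniqueness, for every steady-state family, `T > 0`.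

## The line (idea card `Ideas/jensen-thouless-window.md`, planned in SINGLE-BOND variables as the
triage panel asked — TRIAGE-r1-1/2/3)

Notation (equilibrium open chain, both baths at `T`; constructed objects
`OscillatorChain.transitionKernel P N T T s`, `OscillatorChain.gibbsMeasure P N T`): for a bond
`(b, b+1)`, `b + 1 < N`, let `j_b = P.bondCurrent N b`, `P_s j_b(x) = ∫ j_b d(transitionKernel s x)`,
the WINDOWED TRANSPORT FORECAST `W_b^τ(x) := ∫₀^τ P_s j_b(x) ds = E_x[heat through b during [0,τ]]`,
the (one-sided) transport forecast `u_b := lim_{τ→∞} W_b^τ` (Kubo corrector `(−L)⁻¹ j_b`), and the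
route's bond-heat variance `V_N(b,τ) := 2∫₀^τ (τ−s) C_N(b,s) ds`, `C_N(b,s) = ∫ j_b · P_s j_b dμ_T`
(literally the `let C, V` of `SubdiffusiveBondHeat`).

  K_N := limsup δ⁻² KL(μ_δ ‖ Θμ_δ)
       ≤ ½‖h − h∘Θ‖²_{L²(μ_{T,T})}                    (stub_snapshotKLSecondOrder, fixed N)
       ≤ 2‖u_b‖²_{L²(Gibbs)}/T⁴   for EVERY bond b    (stub_oddDensityForecast, fixed N:
                                                        McLennan + cut identity h − hΘ = ±(u_b − u_bΘ)/T²)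
       ≤ 2·M(c)·‖W_b^{cN²}‖²/T⁴                        (stub_thoulessDomination, N-UNIFORM, lam,β>0:
                                                        the forecast is dominated by its Thouless window)
       ≤ 2·M(c)·V_N(b, cN²)/T⁴                         (stub_jensenWindow, fixed N: conditional Jensen
                                                        ‖E_·[Q]‖² ≤ Var Q, Gibbs stationarity, Markov)
       ≤ 2·M(c)·A√c·N/T⁴           at the bond of (S)  (route item SubdiffusiveBondHeat BY NAME,
                                                        evaluated at t = cN²).

`N = 0, 1` are the landed lemmas `extensiveSnapshotIrreversibility_bound_at_zero/_at_one`
(Negative/DegenerateInstances, p72631); finitely many small `N ≥ 2` are absorbed into `C` by the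
fixed-`N` threshold of stub_snapshotKLSecondOrder alone.

So, exactly as the card claims, (K) stops being an independent N-uniform input of the route: it is
the route's own rank-2 crux (S) (at ONE bond, one time — no all-bond strengthening, no `(N−1)²`
Cauchy–Schwarz, cf. TRIAGE-r1-1 "plan it in the single-bond variables") + ONE relative, diffusive-
scale statement about one explicit `L²` vector (Thouless domination, `∀ c > 0 ∃ M(c)` — the
quantifier coupling asked by TRIAGE-r1-2) + two fixed-`N` identifications.

## Mechanics
* Registered stubs = the four `theorem stub_… := by sorry` below (signatures self-contained over tree
  declarations; no local definition occurs in them; `sorry` occurs nowhere else).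
* `ExtensiveSnapshotIrreversibility_of (hS : SubdiffusiveBondHeat) : <crux decl>` is the skeleton: its
  only hypothesis is the route item (S) (a registered obligation, by name), it concludes the crux decl BY
  NAME, and its body is the complete composition (real arithmetic + the two landed degenerate-instance
  lemmas) calling the four stubs — `#h21_check_skeleton` ok; `closed` flips when the stub bodies land.
* Disproof.lean honoured: the family hypothesis is USED (stub_snapshotKLSecondOrder is about the
  steady states `μ N (T ± δ/2)` themselves — `false_without_family`), `0 < T` is used throughout
  (Gibbs at `T`, `T⁻⁴` — `false_without_Tpos` / `false_with_T_nonneg`), the conclusion is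
  eventual in `δ` (`false_withAllDelta`), and anharmonicity `lam, β > 0` is a hypothesis of every
  stub; it is load-bearing for the LINE through (S), which is false at the harmonic corner
  (`V ∝ G_N t`), while stub_thoulessDomination itself holds there numerically (see its docstring) —
  consistent with §4 StrengtheningBounded: the line outputs only `C·N` (its bound at the corner is
  `≍ N²`, never `o(N)`).  No stub is an instance of a landed Negative lemma.
-/

namespace Summit.AtomisticToContinuum.FouriersLaw.Cruxes.ExtensiveSnapshotIrreversibility.JensenThoulessWindow

open MeasureTheory Filter Topology InformationTheory
open scoped ENNReal NNReal BigOperators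
open Literature.MathematicalPhysics.KineticTheory.HeatConduction
open Summit.AtomisticToContinuum.FouriersLaw.Theses.BondHeatUncertainty

noncomputable section

/-! ## The four REGISTERED stubs (`theorem stub_… := by sorry`; `ledger skeleton check` registers their source
signatures on the crux item; `sorry` occurs nowhere else in this file) -/

/-- **stub_snapshotKLSecondOrder**
(fixed `N ≥ 2`; size L; the KL half of the identification).
Under weak-NESS uniqueness, along the steady-state family `μ`, at `T > 0`: the linear-response
density `h` of `δ ↦ μ_{N,T+δ/2,T−δ/2}` at `δ = 0` EXISTS in `L²(μ_{N,T,T})` (weak derivative tested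
on `C_c^∞` observables and on the bond currents — verbatim the interface of
`OddSectorIrreversibility.ResponseDensity`, stmt-9144), and the snapshot divergence is second order
with curvature at most the odd part of `h`:
`limsup_{δ→0} δ⁻² KL(μ_δ ‖ Θ_*μ_δ) ≤ ½ ∫ (h − h∘Θ)² dμ_{N,T,T}`, stated in the consumable form
"`∀ K > ½∫(h−hΘ)², eventually KL ≤ K δ²`" (which carries FINITENESS of the KL for small `δ ≠ 0`:
positive smooth NESS density, hypoellipticity + control, and integrability of the log-ratio).
Truth: equality (`ReversalKLSecondOrder`, stmt-9145: first order vanishes, `−½δ²∫(h² − (hΘ)²) = 0`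
by `Θ`-invariance of `μ_T`).  Why plausible: fixed-`N` perturbation theory of the hypoelliptic
Langevin chain (HairerMajda2009 Thm 2.3 framework with Lyapunov function `e^{θH}`, CEHR2018 (2.5);
real-analyticity in the bath temperatures for EPR reservoirs, EckmannPilletReyBellet1999b).
Uses the FAMILY hypothesis and `0 < T` (Disproof `false_without_family`, `false_without_Tpos`).
Leans on: CuneoEckmannHairerReyBellet2018_pinnedChain(_holds), pinnedChain_isSteadyState_gibbsMeasure,
InformationTheory.klDiv API (toReal_klDiv…, integral_llr…), gibbsMeasure_map_flip (landed). -/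
theorem stub_snapshotKLSecondOrder :
    ∀ ω₂ lam β γ : ℝ, 0 < ω₂ → 0 < lam → 0 < β → 0 < γ →
    (∀ (N : ℕ) (T_L T_R : ℝ), 0 < T_L → 0 < T_R → ∀ μ ν : Measure (PhaseSpace N),
      (pinnedChain ω₂ lam β γ).IsSteadyState N T_L T_R μ →
      (pinnedChain ω₂ lam β γ).IsSteadyState N T_L T_R ν → μ = ν) →
    ∀ μ : (N : ℕ) → ℝ → ℝ → Measure (PhaseSpace N),
    (∀ (N : ℕ) (T_L T_R : ℝ), 0 < T_L → 0 < T_R →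
      (pinnedChain ω₂ lam β γ).IsSteadyState N T_L T_R (μ N T_L T_R)) →
    ∀ T : ℝ, 0 < T → ∀ N : ℕ, 2 ≤ N →
    ∃ h : PhaseSpace N → ℝ,
      (MemLp h 2 (μ N T T) ∧
        (∀ F : PhaseSpace N → ℝ, ContDiff ℝ ((⊤ : ℕ∞) : WithTop ℕ∞) F → HasCompactSupport F →
          Tendsto (fun δ : ℝ => ((∫ x, F x ∂(μ N (T + δ / 2) (T - δ / 2))) - ∫ x, F x ∂(μ N T T)) / δ)
            (𝓝[≠] (0 : ℝ)) (𝓝 (∫ x, F x * h x ∂(μ N T T)))) ∧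
        (∀ i : Fin N, Tendsto (fun δ : ℝ =>
            ((∫ x, (pinnedChain ω₂ lam β γ).bondCurrent N i x ∂(μ N (T + δ / 2) (T - δ / 2))) -
              ∫ x, (pinnedChain ω₂ lam β γ).bondCurrent N i x ∂(μ N T T)) / δ)
            (𝓝[≠] (0 : ℝ)) (𝓝 (∫ x, (pinnedChain ω₂ lam β γ).bondCurrent N i x * h x ∂(μ N T T))))) ∧
      ∀ K : ℝ, (1 / 2 : ℝ) * ∫ x, (h x - h (x.1, -x.2)) ^ 2 ∂(μ N T T) < K →
        ∀ᶠ δ in 𝓝[≠] (0 : ℝ),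
          klDiv (μ N (T + δ / 2) (T - δ / 2))
            (Measure.map (fun x : PhaseSpace N => (x.1, -x.2)) (μ N (T + δ / 2) (T - δ / 2)))
            ≤ ENNReal.ofReal (K * δ ^ 2) := by
  sorry

/-- **stub_oddDensityForecast**
(fixed `N`, every bond `b`, `b + 1 < N`; size L; the McLennan /
single-cut half of the identification).  Under the guard, along the family `μ`, at `T > 0`, for
ANY response density `h` (same interface as above; it is unique a.e.): the one-sided TRANSPORT
FORECAST through bond `b`, `u_b(x) := lim_{τ→∞} ∫₀^τ (P_s j_b)(x) ds` (the Kubo corrector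
`(−L)⁻¹ j_b` of the EQUILIBRIUM open chain, `P_s` = `transitionKernel N T T s`), exists as an a.e.
limit, lies in `L²(Gibbs_T)`, and controls the odd part of `h`:
`½ ∫ (h − h∘Θ)² dμ_{N,T,T} ≤ 2 ∫ u_b² dGibbs_T / T⁴`.
Truth behind it (what the prover shows): `μ_{N,T,T} = Gibbs_T` (guard +
`pinnedChain_isSteadyState_gibbsMeasure`); `−L†h = s := (γ/2T²)(p_0² − p_{N−1}²)` and generalised
detailed balance `L† = ΘLΘ` give `h = ((−L)⁻¹ s)∘Θ`; the cut identity
`L R_b = j_b + γ(T − p_{N−1}²)` (energy balance of the part right of the bond, cf.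
`generator_hamiltonian_two_baths`, `sum_bondCurrent_eq_poisson`) and `L H̃ = −γ(p_0²−T) − γ(p_{N−1}²−T)`
give `(−L)⁻¹ s = (H̃ − 2R̃_b ∓ 2u_b)/(2T²)` with `H̃, R̃_b` EVEN, hence `h − h∘Θ = ±(u_b − u_b∘Θ)/T²`
a.e. for EVERY bond `b` (bond-freeness, checked to 1e-31 on the harmonic member by the triage), and
`∫(u_b − u_bΘ)² ≤ 4∫u_b²` by `Θ`-invariance of Gibbs — i.e. `K_N = 2‖P_odd u_b‖²/T⁴ ≤ 2‖u_b‖²/T⁴`.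
Convergence of the forecast: CEHR2018 Thm 2.13 / (2.5) exponential mixing at fixed `N` in the
`e^{θH}`-weighted norm, `2θ < 1/T`.  Single-bond form of `OddSectorIrreversibility.OddDensityIsCorrector`
(stmt-9146).  Leans on: pinnedChain_transitionKernel_add, pinnedChain_integral_transitionKernel,
pinnedChain_isSteadyState_gibbsMeasure, generator_hamiltonian_two_baths, sum_bondCurrent_eq_poisson,
gibbsMeasure_map_flip, integral_comp_momentumReversal. -/
theorem stub_oddDensityForecast :
    ∀ ω₂ lam β γ : ℝ, 0 < ω₂ → 0 < lam → 0 < β → 0 < γ →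
    (∀ (N : ℕ) (T_L T_R : ℝ), 0 < T_L → 0 < T_R → ∀ μ ν : Measure (PhaseSpace N),
      (pinnedChain ω₂ lam β γ).IsSteadyState N T_L T_R μ →
      (pinnedChain ω₂ lam β γ).IsSteadyState N T_L T_R ν → μ = ν) →
    ∀ μ : (N : ℕ) → ℝ → ℝ → Measure (PhaseSpace N),
    (∀ (N : ℕ) (T_L T_R : ℝ), 0 < T_L → 0 < T_R →
      (pinnedChain ω₂ lam β γ).IsSteadyState N T_L T_R (μ N T_L T_R)) →
    ∀ T : ℝ, 0 < T → ∀ (N b : ℕ), b + 1 < N →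
    ∀ h : PhaseSpace N → ℝ,
      (MemLp h 2 (μ N T T) ∧
        (∀ F : PhaseSpace N → ℝ, ContDiff ℝ ((⊤ : ℕ∞) : WithTop ℕ∞) F → HasCompactSupport F →
          Tendsto (fun δ : ℝ => ((∫ x, F x ∂(μ N (T + δ / 2) (T - δ / 2))) - ∫ x, F x ∂(μ N T T)) / δ)
            (𝓝[≠] (0 : ℝ)) (𝓝 (∫ x, F x * h x ∂(μ N T T)))) ∧
        (∀ i : Fin N, Tendsto (fun δ : ℝ =>
            ((∫ x, (pinnedChain ω₂ lam β γ).bondCurrent N i x ∂(μ N (T + δ / 2) (T - δ / 2))) -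
              ∫ x, (pinnedChain ω₂ lam β γ).bondCurrent N i x ∂(μ N T T)) / δ)
            (𝓝[≠] (0 : ℝ)) (𝓝 (∫ x, (pinnedChain ω₂ lam β γ).bondCurrent N i x * h x ∂(μ N T T))))) →
    ∃ u : PhaseSpace N → ℝ,
      MemLp u 2 ((pinnedChain ω₂ lam β γ).gibbsMeasure N T) ∧
      (∀ᵐ x ∂((pinnedChain ω₂ lam β γ).gibbsMeasure N T),
        Tendsto (fun τ : ℝ => ∫ s in (0 : ℝ)..τ,
            (if hb : b < N then ∫ y, (pinnedChain ω₂ lam β γ).bondCurrent N ⟨b, hb⟩ y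
                ∂((pinnedChain ω₂ lam β γ).transitionKernel N T T s.toNNReal x) else 0))
          atTop (𝓝 (u x))) ∧
      (1 / 2 : ℝ) * ∫ x, (h x - h (x.1, -x.2)) ^ 2 ∂(μ N T T)
        ≤ 2 * (∫ x, (u x) ^ 2 ∂((pinnedChain ω₂ lam β γ).gibbsMeasure N T)) / T ^ 4 := by
  sorry

/-- **stub_jensenWindow**
(fixed `N`, every bond, every `τ ≥ 0`; size M–L; provable now modulo the
two kernel facts every card of this crux leans on).  The windowed transport forecast
`W_b^τ(x) = ∫₀^τ (P_s j_b)(x) ds` is in `L²(Gibbs_T)` and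
`∫ (W_b^τ)² dGibbs_T ≤ V_N(b,τ) := 2∫₀^τ (τ−s) C_N(b,s) ds`, `C_N(b,s) = ∫ j_b · P_s j_b dGibbs_T`
— the right-hand side is LITERALLY the `V` of the route's (S) `SubdiffusiveBondHeat`.
Proof idea ("you cannot predict more transport than fluctuates"): for the stationary Markov
process started from Gibbs (kernels `transitionKernel N T T`, Chapman–Kolmogorov
`pinnedChain_transitionKernel_add`, Gibbs INVARIANT under the kernels — the missing tree lemma
flagged by grounder g18-12 / BoundaryKernelBasics(a)), `W_b^τ(x) = E_x[Q^τ]` with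
`Q^τ = ∫₀^τ j_b(X_s) ds` (Fubini), so conditional Jensen gives `∫ (E_x Q^τ)² dμ_T(x) ≤ E[(Q^τ)²]
= Var(Q^τ)` (`E Q^τ = τ μ_T(j_b) = 0`, `j_b` odd, `pinnedChain_integral_bondCurrent_gibbsMeasure`)
`= 2∫₀^τ (τ−s) C_N(b,s) ds` (stationarity).  A kernel-only route: discretise `[0,τ]`, prove the
finite-dimensional inequality for compositions of the kernels (Jensen for `κ x`:
`(∫ f dκ_x)² ≤ ∫ f² dκ_x`), pass to the limit by `L²`-continuity of `s ↦ P_s j_b`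
(`pinnedChain_continuous_integral_transitionKernel`).  Harmonic check (triage, evidence-harmonic-
purepy.txt): the inequality holds at all `t`, near-equality as `t → 0`.
Leans on: pinnedChain_transitionKernel_add, pinnedChain_isMarkovKernel_transitionKernel,
pinnedChain_integral_transitionKernel, pinnedChain_measurable_transitionKernel,
pinnedChain_integrable_bondCurrent_mul_gibbsDensity, Mathlib `ProbabilityTheory.Kernel` composition /
`condExp` Jensen or plain Cauchy–Schwarz for kernels, `intervalIntegral`, Fubini. -/
theorem stub_jensenWindow :
    ∀ ω₂ lam β γ : ℝ, 0 < ω₂ → 0 < lam → 0 < β → 0 < γ → ∀ T : ℝ, 0 < T →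
    ∀ (N b : ℕ), b + 1 < N → ∀ τ : ℝ, 0 ≤ τ →
    MemLp (fun x : PhaseSpace N => ∫ s in (0 : ℝ)..τ,
        (if hb : b < N then ∫ y, (pinnedChain ω₂ lam β γ).bondCurrent N ⟨b, hb⟩ y
            ∂((pinnedChain ω₂ lam β γ).transitionKernel N T T s.toNNReal x) else 0)) 2
      ((pinnedChain ω₂ lam β γ).gibbsMeasure N T) ∧
    ∫ x, (∫ s in (0 : ℝ)..τ,
        (if hb : b < N then ∫ y, (pinnedChain ω₂ lam β γ).bondCurrent N ⟨b, hb⟩ y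
            ∂((pinnedChain ω₂ lam β γ).transitionKernel N T T s.toNNReal x) else 0)) ^ 2
      ∂((pinnedChain ω₂ lam β γ).gibbsMeasure N T)
      ≤ 2 * ∫ s in (0 : ℝ)..τ, (τ - s) *
          (if hb : b < N then ∫ z, (pinnedChain ω₂ lam β γ).bondCurrent N ⟨b, hb⟩ z *
              (∫ y, (pinnedChain ω₂ lam β γ).bondCurrent N ⟨b, hb⟩ y
                ∂((pinnedChain ω₂ lam β γ).transitionKernel N T T s.toNNReal z))
              ∂((pinnedChain ω₂ lam β γ).gibbsMeasure N T) else 0) := by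
  sorry

/-- **stub_thoulessDomination**
(N-UNIFORM; the line's own residual and its HARDEST stub; size XL —
nothing N-uniform is proved for a deterministic anharmonic bulk).  For `lam, β > 0`, `T > 0` and
EVERY `c > 0` there are `M = M(c, T, params)` and `N₀` such that for all `N ≥ N₀`, all bonds `b`
and the transport forecast `u_b` (characterised as the a.e. limit of the windows, as in
stub_oddDensityForecast): `‖u_b‖²_{L²(Gibbs_T)} ≤ M · ‖W_b^{cN²}‖²_{L²(Gibbs_T)}` — the whole
forecast is dominated by its THOULESS-WINDOW part, uniformly in `N`.  It is the "domination" form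
(exactly what the composition consumes) of the card's ThoulessContraction
`‖P_{cN²} u_b‖ ≤ θ(c)‖u_b‖`, `θ < 1` (which implies it with `M = (1−θ)⁻²`, since
`P_τ u_b = u_b − W_b^τ`): relative, one explicit vector, rate `≍ 1/N²` — two powers of `N` below
the catalogued rate obstructions (equilibrium_rate_bound `≍ ln N/√N` for the EVEN energy, to which
`u_b`'s slow content is orthogonal at leading order; BeckerMenegaki2022 harmonic `N⁻³` band edge).
Quantifiers `∀ c > 0 ∃ M(c)` as the triage required (P_t contracts, (S) fixes its own `c`).
Why plausible (diffusive phenomenology): `u_b ≈ Σ_y φ_b(y) ẽ_y` with the piecewise-linear exit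
profile `|φ_b| ≤ 1`, so `‖u_b‖² ≍ χN/3`, while the window of length `cN²` captures the energy
within `√(D c)·N` of the bond: `M(c) ≍ max(1, 1/√(Dc))`, and `θ(c) ≈ e^{−π²Dc}`.
Why it might fail: a family of structures overlapping `j_b` whose share of the (extensive) forecast
norm does not vanish and whose lifetime is `≫ N²` (breather-like trapping at `β ≫ lam`, kinetic
bottlenecks at low `T`) would make `M` grow with `N`.  HARMONIC CORNER (planner's exact Gaussian
calibration, folder `harmonic/`, pure python, `ω₂ = γ = T = 1`, reproduces `K_N = N/6 − 2/9`):
`‖u_b‖²/N = 0.28 → 0.31` (N = 12 → 32: the forecast norm is EXTENSIVE at the corner, as the two-bath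
sum rule `‖Q_R‖² ≤ ½ Var H + 2T⁴‖h‖²` predicts) and at `τ = cN²`, `c = 1`: `‖W‖²/‖u‖² = 0.90–0.99`,
late fraction `‖P_{cN²}u_b‖²/‖u_b‖² = 3.5, 3.4, 3.2, 3.1 %` (b = 0) / `1.4, 1.8, 2.1, 2.1 %` (middle
bond) for N = 12, 16, 24, 32 (`γ = 0.2`: 8.1 → 5.6 %, decreasing) — so the stub HOLDS at the corner
with `M ≈ 1.1` (band-edge modes slower than `N²` are a vanishing fraction `≍ √(γ/(cN))` of the
spectrum); the card's "false at lam = β = 0" was an extrapolation from ballistic windows `τ ≤ 8N`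
and is not borne out at the Thouless scale.  Consequence: the corner is NOT a cheap falsifier of
this stub (and need not be: (K) is true there; anharmonicity is load-bearing for the LINE through
(S), which is false there).  Cheapest falsifier: equilibrium MD (pinnedChain 1 1 1 1, N = 16, 32,
64; c = ½, 1, 2), forecast by replica averaging: `‖W^{cN²}‖²/‖u‖²` decreasing towards 0 with `N` at
fixed `c` kills the stub.
Leans on: nothing in tree beyond the kernels; HairerMattingly2009 / CEHR2018 give fixed-`N` rates only. -/
theorem stub_thoulessDomination :
    ∀ ω₂ lam β γ : ℝ, 0 < ω₂ → 0 < lam → 0 < β → 0 < γ → ∀ T : ℝ, 0 < T →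
    ∀ c : ℝ, 0 < c → ∃ M : ℝ, ∃ N₀ : ℕ, ∀ N : ℕ, N₀ ≤ N → ∀ b : ℕ, b + 1 < N →
    ∀ u : PhaseSpace N → ℝ, MemLp u 2 ((pinnedChain ω₂ lam β γ).gibbsMeasure N T) →
    (∀ᵐ x ∂((pinnedChain ω₂ lam β γ).gibbsMeasure N T),
      Tendsto (fun τ : ℝ => ∫ s in (0 : ℝ)..τ,
          (if hb : b < N then ∫ y, (pinnedChain ω₂ lam β γ).bondCurrent N ⟨b, hb⟩ y
              ∂((pinnedChain ω₂ lam β γ).transitionKernel N T T s.toNNReal x) else 0))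
        atTop (𝓝 (u x))) →
    ∫ x, (u x) ^ 2 ∂((pinnedChain ω₂ lam β γ).gibbsMeasure N T)
      ≤ M * ∫ x, (∫ s in (0 : ℝ)..(c * (N : ℝ) ^ 2),
          (if hb : b < N then ∫ y, (pinnedChain ω₂ lam β γ).bondCurrent N ⟨b, hb⟩ y
              ∂((pinnedChain ω₂ lam β γ).transitionKernel N T T s.toNNReal x) else 0)) ^ 2
        ∂((pinnedChain ω₂ lam β γ).gibbsMeasure N T) := by
  sorry

/-! ## The composition: the four stubs and the route's (S) give the crux, BY NAME -/

/-- **The line = the crux proof skeleton.**  From the four registered stubs and the route item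
`SubdiffusiveBondHeat` (stmt-AtomisticToContinuum-9120, a registered obligation taken BY NAME and used
VERBATIM at its own bond and at the single time `t = cN²`), the crux `ExtensiveSnapshotIrreversibility`
(stmt-AtomisticToContinuum-9121) BY NAME.  The composition itself is complete (no `sorry` of its own:
real arithmetic, `N = 0, 1` by the landed degenerate-instance lemmas, finitely many small `N` absorbed
into the constant by the fixed-`N` threshold of `stub_snapshotKLSecondOrder`); it becomes the crux proof,
modulo (S), when the four stub bodies are discharged. -/
theorem ExtensiveSnapshotIrreversibility_of (hS : SubdiffusiveBondHeat) :
    Summit.AtomisticToContinuum.FouriersLaw.Theses.BondHeatUncertainty.ExtensiveSnapshotIrreversibility := by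
  -- the four registered stubs (the ONLY place `sorry` enters); to re-abstract the composition over the
  -- statements, turn these four `have`s into hypotheses — nothing below refers to the stubs otherwise
  have hA1 := stub_snapshotKLSecondOrder
  have hA2 := stub_oddDensityForecast
  have hB := stub_jensenWindow
  have hC := stub_thoulessDomination
  intro ω₂ lam β γ hω hl hβ hγ hU μ hμ T hT
  -- (1) fixed-N thresholds for every N ≥ 2 (stub_snapshotKLSecondOrder alone)
  have small : ∀ N : ℕ, 2 ≤ N → ∃ K₀ : ℝ, ∀ K : ℝ, K₀ < K → ∀ᶠ δ in 𝓝[≠] (0 : ℝ),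
      klDiv (μ N (T + δ / 2) (T - δ / 2))
        (Measure.map (fun x : PhaseSpace N => (x.1, -x.2)) (μ N (T + δ / 2) (T - δ / 2)))
        ≤ ENNReal.ofReal (K * δ ^ 2) := by
    intro N hN
    obtain ⟨h, -, hKL⟩ := hA1 ω₂ lam β γ hω hl hβ hγ hU μ hμ T hT N hN
    exact ⟨_, hKL⟩
  choose! Kf hKf using small
  -- (2) the diffusive input (S) of the route at its own bond, and the domination constant at the same c
  obtain ⟨A, c, hc, N₀, hSN⟩ := hS ω₂ lam β γ hω hl hβ hγ T hT
  obtain ⟨M, N₁, hCN⟩ := hC ω₂ lam β γ hω hl hβ hγ T hT c hc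
  -- (3) the constant
  have hT4 : 0 < T ^ 4 := by positivity
  obtain ⟨K1, hK1⟩ : ∃ K : ℝ, K = 2 * max M 0 * max A 0 * Real.sqrt c / T ^ 4 := ⟨_, rfl⟩
  have hK10 : 0 ≤ K1 := by rw [hK1]; positivity
  obtain ⟨Nbig, hNbig⟩ : ∃ n : ℕ, n = max (max N₀ N₁) (⌈1 / c⌉₊ + 2) := ⟨_, rfl⟩
  obtain ⟨Ssum, hSsum⟩ : ∃ s : ℝ, s = ∑ n ∈ Finset.range Nbig, max (Kf n) 0 := ⟨_, rfl⟩
  have hSsum0 : 0 ≤ Ssum := by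
    rw [hSsum]; exact Finset.sum_nonneg fun n _ => le_max_right _ _
  refine ⟨K1 + 1 + Ssum, fun N => ?_⟩
  obtain hN | hN | hN2 : N = 0 ∨ N = 1 ∨ 2 ≤ N := by omega
  · subst hN
    exact Summit.AtomisticToContinuum.FouriersLaw.Theorems.ExtensiveSnapshotIrreversibility.Negative.extensiveSnapshotIrreversibility_bound_at_zero
      hμ hT _
  · subst hN
    exact Summit.AtomisticToContinuum.FouriersLaw.Theorems.ExtensiveSnapshotIrreversibility.Negative.extensiveSnapshotIrreversibility_bound_at_one
      hω hl hβ hU hμ hT _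
  have hN1 : (1 : ℝ) ≤ N := by exact_mod_cast (show 1 ≤ N by omega)
  have hCmul : K1 + 1 + Ssum ≤ (K1 + 1 + Ssum) * N := le_mul_of_one_le_right (by linarith) hN1
  rcases Nat.lt_or_ge N Nbig with hNs | hNb
  · -- (4a) finitely many small N: the fixed-N threshold is absorbed in the constant
    apply hKf N hN2
    have h1 : max (Kf N) 0 ≤ Ssum := by
      rw [hSsum]
      exact Finset.single_le_sum (f := fun n => max (Kf n) 0) (fun n _ => le_max_right _ _)
        (Finset.mem_range.2 hNs)
    have h2 : Kf N ≤ max (Kf N) 0 := le_max_left _ _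
    linarith
  · -- (4b) large N: (S) at its bond and at t = cN², Jensen window, Thouless domination, identification
    have hN0 : N₀ ≤ N := by
      have := le_max_left (max N₀ N₁) (⌈1 / c⌉₊ + 2); have := le_max_left N₀ N₁; omega
    have hN1' : N₁ ≤ N := by
      have := le_max_left (max N₀ N₁) (⌈1 / c⌉₊ + 2); have := le_max_right N₀ N₁; omega
    have hNc : ⌈1 / c⌉₊ + 2 ≤ N := by
      have := le_max_right (max N₀ N₁) (⌈1 / c⌉₊ + 2); omega
    obtain ⟨b, hb, hVt⟩ := hSN N hN0
    -- the Thouless time t = cN² lies in the window [1, cN²] of (S)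
    have hcN : 1 ≤ c * (N : ℝ) ^ 2 := by
      have h1 : (1 / c : ℝ) ≤ ⌈1 / c⌉₊ := Nat.le_ceil _
      have h2 : ((⌈1 / c⌉₊ + 2 : ℕ) : ℝ) ≤ N := by exact_mod_cast hNc
      push_cast at h2
      have h3 : 1 / c ≤ (N : ℝ) := by linarith
      have h4 : 1 ≤ c * N := by
        have := mul_le_mul_of_nonneg_left h3 hc.le
        rwa [mul_one_div_cancel hc.ne'] at this
      nlinarith
    have hV := hVt (c * (N : ℝ) ^ 2) hcN le_rfl
    obtain ⟨h, hRD, hKL⟩ := hA1 ω₂ lam β γ hω hl hβ hγ hU μ hμ T hT N hN2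
    obtain ⟨u, hu2, hulim, hle⟩ := hA2 ω₂ lam β γ hω hl hβ hγ hU μ hμ T hT N b hb h hRD
    have hdom := hCN N hN1' b hb u hu2 hulim
    obtain ⟨-, hwin⟩ := hB ω₂ lam β γ hω hl hβ hγ T hT N b hb (c * (N : ℝ) ^ 2) (by positivity)
    have hsq : Real.sqrt (c * (N : ℝ) ^ 2) = Real.sqrt c * N := by
      rw [Real.sqrt_mul hc.le, Real.sqrt_sq (Nat.cast_nonneg N)]
    -- ∫ u² ≤ max M 0 · ∫ (W^{cN²})² ≤ max M 0 · V(cN²) ≤ max M 0 · max A 0 · √c · N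
    have step1 := le_trans hdom
      (mul_le_mul_of_nonneg_right (le_max_left M 0) (integral_nonneg fun _ => sq_nonneg _))
    have step2 := le_trans step1 (mul_le_mul_of_nonneg_left hwin (le_max_right M 0))
    have step3 : ∫ x, (u x) ^ 2 ∂((pinnedChain ω₂ lam β γ).gibbsMeasure N T)
        ≤ max M 0 * (max A 0 * (Real.sqrt c * N)) := by
      refine le_trans step2 (mul_le_mul_of_nonneg_left ?_ (le_max_right M 0))
      refine le_trans hV ?_
      rw [← hsq]
      exact mul_le_mul_of_nonneg_right (le_max_left A 0) (Real.sqrt_nonneg _)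
    have hfin : 2 * (∫ x, (u x) ^ 2 ∂((pinnedChain ω₂ lam β γ).gibbsMeasure N T)) / T ^ 4
        < (K1 + 1 + Ssum) * N := by
      have e1 : 2 * (∫ x, (u x) ^ 2 ∂((pinnedChain ω₂ lam β γ).gibbsMeasure N T)) / T ^ 4
          ≤ 2 * (max M 0 * (max A 0 * (Real.sqrt c * N))) / T ^ 4 := by gcongr
      have e2 : 2 * (max M 0 * (max A 0 * (Real.sqrt c * N))) / T ^ 4 = K1 * N := by
        rw [hK1]; ring
      have e3 : K1 * N < (K1 + 1 + Ssum) * N := by nlinarith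
      linarith
    apply hKL ((K1 + 1 + Ssum) * N)
    exact lt_of_le_of_lt hle hfin

end

end Summit.AtomisticToContinuum.FouriersLaw.Cruxes.ExtensiveSnapshotIrreversibility.JensenThoulessWindow
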